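import Literature.MathematicalPhysics.QuantumFieldTheory.Balaban1983to89.B4ThmRegionPairEta
import Literature.MathematicalPhysics.QuantumFieldTheory.Balaban1983to89.B4TorusPositivity
import Literature.MathematicalPhysics.QuantumFieldTheory.Balaban1983to89.B4Eq16GreenExists

/-!
# `Balaban1983to89.B4TorusRegionOp` — [Balaban1983RegularityDecay] p. 572 «operators on subsets of a torus T_η which
# we identify with a rectangular parallelepiped in ηZ^d with periodic conditions»: THE OPERATOR (1.3)–(1.6) AND THE
# COVARIANT DERIVATIVE (1.3) OF A REGION `Ω ⊂ T_η` OF THE DISCRETE TORUS, the torus sup-distance, the periodic field,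
# and the comparison with the Neumann operator of the fundamental domain (existence of `G_k(Ω, A)` on the torus for
# EVERY `A`; the torus form dominates the fundamental-domain form)

statement-level skeleton of published theorems with citation tags; proofs where landed; nothing here is a claim about the Yang–Mills mass gap

CITATION HEADER.  T. Bałaban, *Regularity and decay of lattice Green's functions*, Commun. Math. Phys. **89** (1983)
571–597, doi:10.1007/bf01214744 [Balaban1983RegularityDecay] (cell paper B4; held text
`paper:balaban1983-cmp89-regularity-decay`, journal page = PDF page + 570; p. 572 [PDF 2] read by this seat).  Unit
`lit-balaban-r01` gen 9 (B4 fold owner; HOME `run/shared/lean/pub/lit-balaban/`), SKELETON rows **B4.Thm@573** /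
**B4.Eq1.8** (the torus qualifier «Ω ⊂ T_η at a regular A ≠ 0», v1.63 §D), file 1 of the r01 g9 programme «the Theorem on
torus region pairs by periodic lifting».  Imports: r01 g8 `B4ThmRegionPairEta` (the lattice region-pair family, hence
b04's `B4GaugeCovariance` block calculus `b4Op`/`covOp`/`covLap`/`fieldLink`/`transport`, pv17's region data
`B4Lower18RegularRegion.regWt`/`rBlkWt`/`rbaseEmb`/`rstairContour`/`compField`, `B4Lemma21Region.regionOp`/`regionDeriv`),
b04 g5 `B4TorusPositivity` (`wrap`, the period box), p35 g4 `B4Eq16GreenExists` (positivity of `b4Op` for every `A`).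

WHAT IS PRINTED (p. 572 [PDF 2], verbatim).  «We consider a lattice ηZ^d or its subsets, with η = L^{−k} … Another common
case is to consider operators on subsets of a torus T_η which we identify with a rectangular parallelepiped in ηZ^d with
periodic conditions.»; (1.3) «⟨φ,(−Δ^{η,N}_{A,Ω})φ⟩ = Σ_{b⊂Ω} η^d|(D^η_Aφ)(b)|² = Σ_{b⊂Ω} η^d|η^{−1}(U(A_b)φ(b_+) − φ(b_−))|²,
where the summation is over the set of all bonds b = ⟨b_−,b_+⟩ with end-points b_−, b_+ in Ω.»; (1.4)–(1.6) as transcribed in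
`B4GaugeCovariance`; «We identify them [vector fields] with vector-valued functions defined on points of the lattice by the
identity A_{⟨x,x+ηe_μ⟩} = A_μ(x)».

WHAT THIS MODULE PROVES (all in full; lattice units, `d + 1` dimensions, `n = η⁻¹` fine points per unit; the torus
`T_η = Π_ν ℤ/(nP_ν)` has `P_ν` unit blocks per direction and is read on its period box `Π_ν [0, nP_ν)` of representatives;
a torus region `Ω` = the unit blocks with labels in a finite `Ω_T ⊆ Π_ν [0, P_ν)`, carrier `fineDom n Ω_T`).
* §1 `per`, `twrap` (reduction modulo the fine period; `blk_twrap`: the block of the reduction is the reduction of the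
  block), `cdev`/`tnorm` (the torus sup-norm `|z|_T = max_ν dist(z_ν, nP_νℤ)`: `tnorm_le_supNorm` — a lift is never
  shorter, `exists_lift_eq_tnorm` — some lift realises it, `tnorm_add_per`).
* §2 `TNbr` (torus nearest neighbours `v ≡ u ± e_μ`), **`torWt`** (the Neumann bond weights `n²/2` per ordered torus bond of
  `Ω`), **`torBond`** (the torus vector field `A_{⟨x,x+ηe_μ⟩} = A_μ(x)` as an antisymmetric bond function of
  representatives), **`torusOp`** = b04's `b4Op` — THE OPERATOR `−Δ^{η,N}_{A,Ω} + m² + a_kP_k(A)` OF (1.6) ON THE TORUS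
  REGION (same unit blocks, block weights and staircase contours as the lattice region: blocks do not wrap),
  **`torusDeriv`** — `D^η_{A,μ}` (1.3) along the torus bond `⟨x, x+ηe_μ⟩ ⊂ Ω`; `perField` (the periodic extension of the
  component field to `ηℤ^{d+1}`) with `torBond_eq_compField` (on lattice bonds of the period box the torus field IS the
  periodic component field; fine period `≥ 3`).
* §3 `regionOp_form_le_torusOp_form` — THE TORUS FORM DOMINATES THE NEUMANN FORM OF THE FUNDAMENTAL DOMAIN: the wrap-around
  bonds add non-negative terms to (1.3), the block term (1.5) and the mass term are the same (so every lower bound (1.8) for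
  the lattice region `fineDom n Ω_T` at the periodic field is a lower bound for the torus operator);
  `torusOp_posDef`/`torusOp_isUnit_det`/`torusOp_mul_inv`/`inv_mul_torusOp`/`torusOp_mulVec_inv_mulVec` — `G_k(Ω,A) =
  (…)⁻¹` EXISTS ON THE TORUS FOR EVERY `A` (p35's `B4Eq16GreenExists.b4Op_posDef`: staircase steps are torus bonds).
HONEST SCOPE.  Definitions with bodies + bookkeeping; no analytic estimate.  The torus is read on representatives (period
box), as the print does («identify with a rectangular parallelepiped … with periodic conditions»); fine period `nP_ν ≥ 3`
wherever the bond structure must be a simple graph (stated as a hypothesis where used).  Abelian one-parameter flow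
`U = F.U` (the print's (1.2), every antisymmetric `q` via `B4Eq12ExpFlow`).  No `sorry`, no `Prop`-valued fact; axioms
standard.
-/

namespace Literature.MathematicalPhysics.QuantumFieldTheory.Balaban1983to89.B4TorusRegionOp

open Literature.MathematicalPhysics.QuantumFieldTheory.Balaban1983to89.B4TorusPositivity (wrap box mem_box wrap_mem_box
  wrap_eq_self_of_mem wrap_wrap_add wrap_translate)
open Literature.MathematicalPhysics.QuantumFieldTheory.Balaban1983to89.B4Reflection242 (boxDom mem_boxDom nbrs mem_nbrs
  blk blk_mem_boxDom blk_mul)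
open Literature.MathematicalPhysics.QuantumFieldTheory.Balaban1983to89.B4GaugeCovariance
open Literature.MathematicalPhysics.QuantumFieldTheory.Balaban1983to89.B4ContourShift (supNorm supNorm_nonneg
  exists_supNorm_eq abs_le_supNorm)
open Literature.MathematicalPhysics.QuantumFieldTheory.Balaban1983to89.B4Lower18 (fineDom mem_fineDom IsBlockUnion
  fineDom_isBlockUnion)
open Literature.MathematicalPhysics.QuantumFieldTheory.Balaban1983to89.B4Lower18Regular (e1 e1_apply_self e1_apply_ne
  PathRel lsum transport_fieldLink dotProduct_self_nonneg' covOp_form)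
open Literature.MathematicalPhysics.QuantumFieldTheory.Balaban1983to89.B4TorusKernel.MultiPeriod (translate translate_apply)
open Literature.MathematicalPhysics.QuantumFieldTheory.Balaban1983to89.B4Lower18RegularRegion (regWt rBlkWt rbaseEmb
  rstairContour compField regWt_nonneg rBlkWt_nonneg rstairContour_path rstairContour_end rBlkWt_ne_zero covLap_congr
  projOp_congr covOp_congr transport_congr pathRel_mono covLap_form_mono)
open Literature.MathematicalPhysics.QuantumFieldTheory.Balaban1983to89.B4Lemma21Region (regionOp regionDeriv siteNorm
  covDeriv compField_rev fieldLink_rev)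
open Literature.MathematicalPhysics.QuantumFieldTheory.Balaban1983to89.B4Eq16GreenExists (b4Op_posDef rBlkWt_cover)
open scoped Matrix

noncomputable section

variable {d : ℕ}

/-! ## §1. Torus arithmetic: the fine period, reduction of representatives, the torus sup-norm -/

/-- the FINE PERIOD `(nP_ν)_ν` of the torus `T_η = Π_ν ℤ/(nP_ν)` (`P_ν` unit blocks, `n = η⁻¹` fine points per unit).
[cite: Balaban1983RegularityDecay, p.572 «a torus T_η which we identify with a rectangular parallelepiped in ηZ^d with periodic conditions», dictionary] -/
def per (n : ℕ) (P : Fin (d + 1) → ℕ) : Fin (d + 1) → ℕ := fun ν => n * P ν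

/-- the fine period is positive. [cite: Balaban1983RegularityDecay, p.572, dictionary] -/
theorem per_pos {n : ℕ} (hn : 1 ≤ n) {P : Fin (d + 1) → ℕ} (hP : ∀ ν, 1 ≤ P ν) : ∀ ν, 1 ≤ per n P ν :=
  fun ν => Nat.one_le_iff_ne_zero.mpr (Nat.mul_ne_zero (by omega) (by have := hP ν; omega))

/-- REDUCTION of a fine lattice point modulo the fine period: its representative in the period box.
[cite: Balaban1983RegularityDecay, p.572 «periodic conditions», dictionary] -/
def twrap (n : ℕ) (P : Fin (d + 1) → ℕ) (z : Fin (d + 1) → ℤ) : Fin (d + 1) → ℤ := wrap (per n P) z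

/-- the period box of `B4TorusPositivity` is the box `boxDom` of the region lineage. [cite: Balaban1983RegularityDecay, p.572 «a torus T_η … with periodic conditions», dictionary] -/
theorem box_eq_boxDom (N : Fin (d + 1) → ℕ) : box N = boxDom N := rfl

/-- the representative lies in the period box. [cite: Balaban1983RegularityDecay, p.572, dictionary] -/
theorem twrap_mem_boxDom {n : ℕ} (hn : 1 ≤ n) {P : Fin (d + 1) → ℕ} (hP : ∀ ν, 1 ≤ P ν) (z : Fin (d + 1) → ℤ) :
    twrap n P z ∈ boxDom (per n P) := by
  rw [← box_eq_boxDom]; exact wrap_mem_box (per_pos hn hP) z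

/-- points of the period box are their own representatives. [cite: Balaban1983RegularityDecay, p.572, dictionary] -/
theorem twrap_eq_self {n : ℕ} {P : Fin (d + 1) → ℕ} {z : Fin (d + 1) → ℤ} (hz : z ∈ boxDom (per n P)) :
    twrap n P z = z :=
  wrap_eq_self_of_mem (by rw [box_eq_boxDom]; exact hz)

/-- coordinates of the representative. [cite: Balaban1983RegularityDecay, p.572 «a torus T_η … with periodic conditions», dictionary] -/
theorem twrap_apply (n : ℕ) (P : Fin (d + 1) → ℕ) (z : Fin (d + 1) → ℤ) (ν : Fin (d + 1)) :
    twrap n P z ν = z ν % (per n P ν : ℤ) := rfl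

/-- translation by the period lattice does not change the representative. [cite: Balaban1983RegularityDecay, p.572 «periodic conditions», dictionary] -/
theorem twrap_add_per (n : ℕ) (P : Fin (d + 1) → ℕ) (z t : Fin (d + 1) → ℤ) :
    twrap n P (z + fun ν => (per n P ν : ℤ) * t ν) = twrap n P z := by
  have h : (z + fun ν => (per n P ν : ℤ) * t ν) = translate (per n P) z t := by
    funext ν; rfl
  rw [twrap, twrap, h, wrap_translate]

/-- reduction after a shift of a representative = reduction after the shift. [cite: Balaban1983RegularityDecay, p.572 «a torus T_η … with periodic conditions», dictionary] -/
theorem twrap_twrap_add (n : ℕ) (P : Fin (d + 1) → ℕ) (z v : Fin (d + 1) → ℤ) :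
    twrap n P (twrap n P z + v) = twrap n P (z + v) :=
  wrap_wrap_add _ _ _

/-- reduction is idempotent. [cite: Balaban1983RegularityDecay, p.572 «a torus T_η … with periodic conditions», dictionary] -/
theorem twrap_twrap (n : ℕ) (P : Fin (d + 1) → ℕ) (z : Fin (d + 1) → ℤ) : twrap n P (twrap n P z) = twrap n P z := by
  have h := twrap_twrap_add n P z 0
  rwa [add_zero, add_zero] at h

/-- the representative differs from the point by a period vector. [cite: Balaban1983RegularityDecay, p.572 «a torus T_η … with periodic conditions», dictionary] -/
theorem twrap_eq_add_per (n : ℕ) (P : Fin (d + 1) → ℕ) (z : Fin (d + 1) → ℤ) :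
    ∃ t : Fin (d + 1) → ℤ, twrap n P z = z + fun ν => (per n P ν : ℤ) * t ν := by
  refine ⟨fun ν => -(z ν / (per n P ν : ℤ)), funext fun ν => ?_⟩
  simp only [twrap_apply, Pi.add_apply]
  linarith [Int.mul_ediv_add_emod (z ν) (per n P ν : ℤ)]

/-- two points have the same representative iff they differ by a period vector. [cite: Balaban1983RegularityDecay, p.572 «a torus T_η … with periodic conditions», dictionary] -/
theorem twrap_eq_twrap_iff (n : ℕ) (P : Fin (d + 1) → ℕ) (z w : Fin (d + 1) → ℤ) :
    twrap n P z = twrap n P w ↔ ∀ ν, (per n P ν : ℤ) ∣ (z ν - w ν) := by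
  constructor
  · intro h ν
    have hν := congrFun h ν
    simp only [twrap_apply] at hν
    exact Int.modEq_iff_dvd.1 (show Int.ModEq (per n P ν : ℤ) (w ν) (z ν) from hν.symm)
  · intro h
    funext ν
    simp only [twrap_apply]
    exact ((Int.modEq_iff_dvd.2 (h ν) : Int.ModEq (per n P ν : ℤ) (w ν) (z ν))).symm

/-- **THE BLOCK OF THE REPRESENTATIVE IS THE REPRESENTATIVE OF THE BLOCK** (`n ∣ nP_ν`: unit blocks do not wrap).
[cite: Balaban1983RegularityDecay, (1.1) p.572, dictionary] -/
theorem blk_twrap {n : ℕ} (hn : 1 ≤ n) (P : Fin (d + 1) → ℕ) (z : Fin (d + 1) → ℤ) :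
    blk n (twrap n P z) = wrap P (blk n z) := by
  funext ν
  have hn0 : (0 : ℤ) < n := by exact_mod_cast hn
  show (z ν % ((n * P ν : ℕ) : ℤ)) / (n : ℤ) = (z ν / (n : ℤ)) % (P ν : ℤ)
  by_cases hP : P ν = 0
  · simp [hP]
  have hP0 : (0 : ℤ) < (P ν : ℤ) := by exact_mod_cast Nat.pos_of_ne_zero hP
  set p : ℤ := (P ν : ℤ)
  set r : ℤ := z ν % ((n : ℤ) * p) with hr
  set q : ℤ := z ν / ((n : ℤ) * p) with hq
  have hnp : (0 : ℤ) < (n : ℤ) * p := mul_pos hn0 hP0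
  have hr0 : 0 ≤ r := Int.emod_nonneg _ hnp.ne'
  have hr1 : r < (n : ℤ) * p := Int.emod_lt_of_pos _ hnp
  have hz : z ν = (n : ℤ) * p * q + r := (Int.mul_ediv_add_emod (z ν) ((n : ℤ) * p)).symm
  have hcast : ((n * P ν : ℕ) : ℤ) = (n : ℤ) * p := by push_cast; rfl
  rw [hcast]
  have h1 : z ν / (n : ℤ) = r / (n : ℤ) + p * q := by
    rw [hz, show (n : ℤ) * p * q + r = r + (n : ℤ) * (p * q) by ring, Int.add_mul_ediv_left _ _ hn0.ne']
  have h2 : 0 ≤ r / (n : ℤ) := Int.ediv_nonneg hr0 hn0.le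
  have h3 : r / (n : ℤ) < p := by
    rw [Int.ediv_lt_iff_lt_mul hn0]; linarith [mul_comm (n : ℤ) p]
  rw [h1, Int.add_mul_emod_self_left, Int.emod_eq_of_lt h2 h3]

/-- the representative of a point of the fine region over the period box of labels has its block label in the reduced
label set. [cite: Balaban1983RegularityDecay, (1.1) p.572, dictionary] -/
theorem blk_twrap_mem {n : ℕ} (hn : 1 ≤ n) {P : Fin (d + 1) → ℕ} {ΩT : Finset (Fin (d + 1) → ℤ)}
    {z : Fin (d + 1) → ℤ} (hz : wrap P (blk n z) ∈ ΩT) : twrap n P z ∈ fineDom n ΩT := by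
  rw [mem_fineDom hn, blk_twrap hn]; exact hz

/-- the CIRCULAR SIZE of an integer modulo `p`: its distance to `pℤ`. [cite: Balaban1983RegularityDecay, p.572 «a torus T_η … with periodic conditions», dictionary] -/
def cdev (p : ℕ) (r : ℤ) : ℤ := min (r % p) (p - r % p)

/-- the circular size is non-negative. [cite: Balaban1983RegularityDecay, p.572 «a torus T_η … with periodic conditions», dictionary] -/
theorem cdev_nonneg {p : ℕ} (hp : 1 ≤ p) (r : ℤ) : 0 ≤ cdev p r := by
  have hp0 : (0 : ℤ) < p := by exact_mod_cast hp
  unfold cdev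
  exact le_min (Int.emod_nonneg _ hp0.ne') (by linarith [Int.emod_lt_of_pos r hp0])

/-- the circular size is invariant under the period. [cite: Balaban1983RegularityDecay, p.572 «a torus T_η … with periodic conditions», dictionary] -/
theorem cdev_add_mul (p : ℕ) (r t : ℤ) : cdev p (r + p * t) = cdev p r := by
  unfold cdev
  rw [Int.add_mul_emod_self_left]

/-- the circular size is at most the absolute value. [cite: Balaban1983RegularityDecay, p.572 «a torus T_η … with periodic conditions», dictionary] -/
theorem cdev_le_abs {p : ℕ} (hp : 1 ≤ p) (r : ℤ) : cdev p r ≤ |r| := by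
  have hp0 : (0 : ℤ) < p := by exact_mod_cast hp
  unfold cdev
  rcases le_or_gt 0 r with hr | hr
  · rw [abs_of_nonneg hr]
    refine (min_le_left _ _).trans ?_
    have hdiv := Int.mul_ediv_add_emod r (p : ℤ)
    have hq : 0 ≤ (p : ℤ) * (r / p) := mul_nonneg hp0.le (Int.ediv_nonneg hr hp0.le)
    linarith
  · rw [abs_of_neg hr]
    refine (min_le_right _ _).trans ?_
    -- `p - r % p ≤ -r`: `r = p·(r/p) + r % p` with `r/p ≤ -1`
    have hdiv := Int.mul_ediv_add_emod r (p : ℤ)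
    have hmod := Int.emod_nonneg r hp0.ne'
    have hq : r / (p : ℤ) ≤ -1 := by
      have hlt : (p : ℤ) * (r / p) < 0 := by linarith
      have : r / (p : ℤ) < 0 := by
        by_contra h
        exact absurd (mul_nonneg hp0.le (not_lt.1 h)) (not_le.2 hlt)
      linarith
    have : (p : ℤ) * (r / p) ≤ (p : ℤ) * (-1) := mul_le_mul_of_nonneg_left hq hp0.le
    linarith

/-- twice the circular size is at most the period. [cite: Balaban1983RegularityDecay, p.572 «a torus T_η … with periodic conditions», dictionary] -/
theorem two_mul_cdev_le (p : ℕ) (r : ℤ) : 2 * cdev p r ≤ p := by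
  unfold cdev
  rcases le_total (r % p) ((p : ℤ) - r % p) with h | h
  · rw [min_eq_left h]; linarith
  · rw [min_eq_right h]; linarith

/-- some representative realises the circular size. [cite: Balaban1983RegularityDecay, p.572 «a torus T_η … with periodic conditions», dictionary] -/
theorem exists_rep_abs_eq_cdev {p : ℕ} (hp : 1 ≤ p) (r : ℤ) : ∃ t : ℤ, |r + p * t| = cdev p r := by
  have hp0 : (0 : ℤ) < p := by exact_mod_cast hp
  have hdiv := Int.mul_ediv_add_emod r p   -- p * (r / p) + r % p = r
  unfold cdev
  rcases le_total (r % p) ((p : ℤ) - r % p) with h | h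
  · refine ⟨-(r / p), ?_⟩
    rw [min_eq_left h]
    have : r + (p : ℤ) * -(r / p) = r % p := by linarith
    rw [this, abs_of_nonneg (Int.emod_nonneg _ hp0.ne')]
  · refine ⟨-(r / p) - 1, ?_⟩
    rw [min_eq_right h]
    have : r + (p : ℤ) * (-(r / p) - 1) = r % p - p := by linarith
    rw [this, abs_of_nonpos (by linarith [Int.emod_lt_of_pos r hp0])]
    ring

/-- **THE TORUS SUP-NORM** of a fine lattice vector (fine units): `|z|_T = max_ν dist(z_ν, nP_νℤ)` — the sup-distance on
the torus between two points whose representatives differ by `z`. [cite: Balaban1983RegularityDecay, p.572 «torus T_η», (1.9) «dist», dictionary] -/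
def tnorm (n : ℕ) (P : Fin (d + 1) → ℕ) (z : Fin (d + 1) → ℤ) : ℝ := supNorm fun ν => cdev (per n P ν) (z ν)

/-- the torus sup-norm is non-negative. [cite: Balaban1983RegularityDecay, p.572 «a torus T_η … with periodic conditions», dictionary] -/
theorem tnorm_nonneg (n : ℕ) (P : Fin (d + 1) → ℕ) (z : Fin (d + 1) → ℤ) : 0 ≤ tnorm n P z := supNorm_nonneg _

/-- **A LIFT IS NEVER SHORTER**: `|z|_T ≤ |z|_∞`. [cite: Balaban1983RegularityDecay, p.572, dictionary] -/
theorem tnorm_le_supNorm {n : ℕ} (hn : 1 ≤ n) {P : Fin (d + 1) → ℕ} (hP : ∀ ν, 1 ≤ P ν) (z : Fin (d + 1) → ℤ) :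
    tnorm n P z ≤ supNorm z := by
  unfold tnorm
  obtain ⟨i, hi⟩ := exists_supNorm_eq (fun ν => cdev (per n P ν) (z ν))
  rw [hi]
  refine le_trans ?_ (abs_le_supNorm z i)
  have h1 := cdev_le_abs (per_pos hn hP i) (z i)
  have h2 := cdev_nonneg (per_pos hn hP i) (z i)
  rw [abs_of_nonneg h2]
  exact_mod_cast h1

/-- the torus sup-norm is invariant under period translates. [cite: Balaban1983RegularityDecay, p.572 «periodic conditions», dictionary] -/
theorem tnorm_add_per (n : ℕ) (P : Fin (d + 1) → ℕ) (z t : Fin (d + 1) → ℤ) :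
    tnorm n P (z + fun ν => (per n P ν : ℤ) * t ν) = tnorm n P z := by
  unfold tnorm
  congr 1
  funext ν
  exact cdev_add_mul _ _ _

/-- **SOME LIFT REALISES THE TORUS DISTANCE**: `|z + nPt|_∞ = |z|_T` for a suitable period vector `t`.
[cite: Balaban1983RegularityDecay, p.572, dictionary] -/
theorem exists_lift_eq_tnorm {n : ℕ} (hn : 1 ≤ n) {P : Fin (d + 1) → ℕ} (hP : ∀ ν, 1 ≤ P ν) (z : Fin (d + 1) → ℤ) :
    ∃ t : Fin (d + 1) → ℤ, supNorm (z + fun ν => (per n P ν : ℤ) * t ν) = tnorm n P z := by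
  choose t ht using fun ν => exists_rep_abs_eq_cdev (per_pos hn hP ν) (z ν)
  refine ⟨t, ?_⟩
  unfold tnorm supNorm
  congr 1
  funext ν
  simp only [Pi.add_apply]
  rw [ht ν, abs_of_nonneg (cdev_nonneg (per_pos hn hP ν) (z ν))]

/-- twice the torus sup-norm is at most the largest fine period. [cite: Balaban1983RegularityDecay, p.572 «a torus T_η … with periodic conditions», dictionary] -/
theorem two_mul_tnorm_le {n : ℕ} (hn : 1 ≤ n) {P : Fin (d + 1) → ℕ} (hP : ∀ ν, 1 ≤ P ν) (z : Fin (d + 1) → ℤ) :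
    ∃ ν, 2 * tnorm n P z ≤ (per n P ν : ℝ) := by
  obtain ⟨i, hi⟩ := exists_supNorm_eq (fun ν => cdev (per n P ν) (z ν))
  refine ⟨i, ?_⟩
  unfold tnorm
  rw [hi, abs_of_nonneg (cdev_nonneg (per_pos hn hP i) (z i))]
  exact_mod_cast two_mul_cdev_le (per n P i) (z i)

/-! ## §2. Torus bonds; the operator (1.6) and the covariant derivative (1.3) of a torus region; the periodic field -/

/-- TORUS NEAREST NEIGHBOURS (on representatives): `v ≡ u + e_μ` or `u ≡ v + e_μ` modulo the fine period — the bonds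
`⟨x, x + ηe_μ⟩` of `T_η`. [cite: Balaban1983RegularityDecay, p.572 «pairs ⟨x, x′⟩ of nearest neighbour points … called bonds», dictionary] -/
def TNbr (n : ℕ) (P : Fin (d + 1) → ℕ) (u v : Fin (d + 1) → ℤ) : Prop :=
  ∃ μ, v = twrap n P (u + e1 μ) ∨ u = twrap n P (v + e1 μ)

/-- the torus bond relation is symmetric. [cite: Balaban1983RegularityDecay, p.572 «a torus T_η … with periodic conditions», dictionary] -/
theorem tNbr_comm {n : ℕ} {P : Fin (d + 1) → ℕ} {u v : Fin (d + 1) → ℤ} : TNbr n P u v ↔ TNbr n P v u := by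
  constructor
  · rintro ⟨μ, h | h⟩
    · exact ⟨μ, Or.inr h⟩
    · exact ⟨μ, Or.inl h⟩
  · rintro ⟨μ, h | h⟩
    · exact ⟨μ, Or.inr h⟩
    · exact ⟨μ, Or.inl h⟩

open Classical in
/-- [B4]'s BOND WEIGHTS of (1.3) ON A TORUS REGION `R`: `n²/2` per ordered torus-nearest-neighbour pair of `R` (Neumann:
both end-points in `R`; `η⁻² = n²`, each bond counted in both orders). [cite: Balaban1983RegularityDecay, (1.3) p.572] -/
def torWt (n : ℕ) (P : Fin (d + 1) → ℕ) (R : Finset (Fin (d + 1) → ℤ)) : ↥R → ↥R → ℝ :=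
  fun u v => (n : ℝ) ^ 2 / 2 * (if TNbr n P u.1 v.1 then 1 else 0)

/-- the torus bond weights are non-negative. [cite: Balaban1983RegularityDecay, p.572 «a torus T_η … with periodic conditions», dictionary] -/
theorem torWt_nonneg (n : ℕ) (P : Fin (d + 1) → ℕ) (R : Finset (Fin (d + 1) → ℤ)) (u v : ↥R) :
    0 ≤ torWt n P R u v := by
  unfold torWt; split_ifs <;> positivity

/-- the torus bond weights are symmetric. [cite: Balaban1983RegularityDecay, p.572 «a torus T_η … with periodic conditions», dictionary] -/
theorem torWt_symm (n : ℕ) (P : Fin (d + 1) → ℕ) (R : Finset (Fin (d + 1) → ℤ)) (u v : ↥R) :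
    torWt n P R u v = torWt n P R v u := by
  unfold torWt
  by_cases h : TNbr n P u.1 v.1
  · rw [if_pos h, if_pos (tNbr_comm.1 h)]
  · rw [if_neg h, if_neg (fun h' => h (tNbr_comm.1 h'))]

/-- **THE TORUS VECTOR FIELD AS A BOND FUNCTION** of representatives: `A(x, x + ηe_μ) = A_μ(x)` for the torus bond
`⟨x, x+ηe_μ⟩` (read modulo the period), the reversed bond carries `−A_μ(x)`, non-bonds `0`.
[cite: Balaban1983RegularityDecay, p.572 «A_{⟨x,x+ηe_μ⟩} = A_μ(x)»] -/
def torBond (n : ℕ) (P : Fin (d + 1) → ℕ) (Ac : (Fin (d + 1) → ℤ) → Fin (d + 1) → ℝ) (u v : Fin (d + 1) → ℤ) : ℝ :=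
  (∑ μ, if v = twrap n P (u + e1 μ) then Ac u μ else 0) - (∑ μ, if u = twrap n P (v + e1 μ) then Ac v μ else 0)

/-- the torus bond function is antisymmetric. [cite: Balaban1983RegularityDecay, p.572 «orientations of the bonds», dictionary] -/
theorem torBond_rev (n : ℕ) (P : Fin (d + 1) → ℕ) (Ac : (Fin (d + 1) → ℤ) → Fin (d + 1) → ℝ) (u v : Fin (d + 1) → ℤ) :
    torBond n P Ac v u = -torBond n P Ac u v := by
  unfold torBond; ring

variable {ι : Type} [Fintype ι] [DecidableEq ι]

/-- **[B4]'s OPERATOR `−Δ^{η,N}_{A,Ω} + m² + a_kP_k(A)` OF (1.6) ON A REGION `Ω` OF THE TORUS `T_η`** (`Ω` = the unit blocks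
with labels in `ΩT`, representatives in the period box): b04's `b4Op` with the torus bond weights and the torus field,
coupling `eη = e/n`, `a_k = a·n^{-(d+1)}`, and the unit blocks, block weights, base corners and staircase contours of the
lattice region `fineDom n ΩT` (unit blocks do not wrap). [cite: Balaban1983RegularityDecay, (1.3)–(1.6) p.572 «operators on subsets of a torus T_η»] -/
def torusOp (F : OrthFlow ι) (e : ℝ) {n : ℕ} (hn : 1 ≤ n) (a m2 : ℝ) (P : Fin (d + 1) → ℕ)
    (ΩT : Finset (Fin (d + 1) → ℤ)) (Ac : (Fin (d + 1) → ℤ) → Fin (d + 1) → ℝ) :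
    Matrix (↥(fineDom n ΩT) × ι) (↥(fineDom n ΩT) × ι) ℝ :=
  b4Op F (e / n) (torWt n P (fineDom n ΩT)) m2 (a * ((n : ℝ) ^ (d + 1))⁻¹) (rBlkWt n ΩT (fineDom n ΩT))
    (rbaseEmb hn ΩT) (rstairContour hn ΩT) (fun u v => torBond n P Ac u.1 v.1)

/-- the block kernel of the torus covariant derivative along `μ`: `n·(U(A_{⟨x,x+ηe_μ⟩})δ_{z, x+ηe_μ} − δ_{z,x})` when the
torus bond `⟨x, x + ηe_μ⟩` lies in `R`, else `0`. [cite: Balaban1983RegularityDecay, (1.3) p.572] -/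
def tdirKer (n : ℕ) (P : Fin (d + 1) → ℕ) (R : Finset (Fin (d + 1) → ℤ)) (W : ↥R → ↥R → Matrix ι ι ℝ)
    (μ : Fin (d + 1)) (x z : ↥R) : Matrix ι ι ℝ :=
  if twrap n P (x.1 + e1 μ) ∈ R then
    (n : ℝ) • ((if z.1 = twrap n P (x.1 + e1 μ) then W x z else 0) - (if z = x then 1 else 0))
  else 0

/-- the covariant derivative `D^η_{W,μ}` of a torus region with link variables `W` (a block operator).
[cite: Balaban1983RegularityDecay, (1.3) p.572] -/
def tcovDeriv (n : ℕ) (P : Fin (d + 1) → ℕ) (R : Finset (Fin (d + 1) → ℤ)) (W : ↥R → ↥R → Matrix ι ι ℝ)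
    (μ : Fin (d + 1)) : Matrix (↥R × ι) (↥R × ι) ℝ :=
  blockOp (tdirKer n P R W μ)

/-- `D^η_{W,μ}φ` at a site whose torus `μ`-bond lies in the region: `n(W(x, x+e_μ)φ(x+e_μ) − φ(x))`.
[cite: Balaban1983RegularityDecay, (1.3) p.572] -/
theorem fld_tcovDeriv_mulVec_of_mem (n : ℕ) (P : Fin (d + 1) → ℕ) {R : Finset (Fin (d + 1) → ℤ)}
    (W : ↥R → ↥R → Matrix ι ι ℝ) {μ : Fin (d + 1)} (Φ : ↥R × ι → ℝ) {x : ↥R} (h : twrap n P (x.1 + e1 μ) ∈ R) :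
    fld (tcovDeriv n P R W μ *ᵥ Φ) x
      = (n : ℝ) • (W x ⟨twrap n P (x.1 + e1 μ), h⟩ *ᵥ fld Φ ⟨twrap n P (x.1 + e1 μ), h⟩ - fld Φ x) := by
  rw [tcovDeriv, fld_blockOp_mulVec]
  have hK : ∀ z : ↥R, tdirKer n P R W μ x z *ᵥ fld Φ z
      = (n : ℝ) • ((if z.1 = twrap n P (x.1 + e1 μ) then W x z *ᵥ fld Φ z else 0)
          - (if z = x then fld Φ z else 0)) := by
    intro z
    rw [tdirKer, if_pos h, Matrix.smul_mulVec, Matrix.sub_mulVec]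
    congr 2
    · split_ifs <;> simp
    · split_ifs <;> simp
  simp_rw [hK]
  rw [← Finset.smul_sum, Finset.sum_sub_distrib, Finset.sum_ite_eq' Finset.univ x, if_pos (Finset.mem_univ _)]
  congr 2
  rw [Finset.sum_eq_single ⟨twrap n P (x.1 + e1 μ), h⟩]
  · rw [if_pos rfl]
  · intro z _ hz
    rw [if_neg]
    intro hz1
    exact hz (Subtype.ext hz1)
  · intro hh; exact absurd (Finset.mem_univ _) hh

/-- `D^η_{W,μ}φ = 0` at a site whose torus `μ`-bond leaves the region (Neumann conditions).
[cite: Balaban1983RegularityDecay, (1.3) p.572] -/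
theorem fld_tcovDeriv_mulVec_of_not_mem (n : ℕ) (P : Fin (d + 1) → ℕ) {R : Finset (Fin (d + 1) → ℤ)}
    (W : ↥R → ↥R → Matrix ι ι ℝ) {μ : Fin (d + 1)} (Φ : ↥R × ι → ℝ) {x : ↥R} (h : twrap n P (x.1 + e1 μ) ∉ R) :
    fld (tcovDeriv n P R W μ *ᵥ Φ) x = 0 := by
  rw [tcovDeriv, fld_blockOp_mulVec]
  refine Finset.sum_eq_zero fun z _ => ?_
  rw [tdirKer, if_neg h, Matrix.zero_mulVec]

/-- **[B4]'s COVARIANT DERIVATIVE `D^η_{A,μ}` (1.3) ON THE TORUS REGION** for the torus field `A_ν(x)` and charge `e`.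
[cite: Balaban1983RegularityDecay, (1.3) p.572] -/
def torusDeriv (F : OrthFlow ι) (e : ℝ) (n : ℕ) (P : Fin (d + 1) → ℕ) (ΩT : Finset (Fin (d + 1) → ℤ))
    (Ac : (Fin (d + 1) → ℤ) → Fin (d + 1) → ℝ) (μ : Fin (d + 1)) :
    Matrix (↥(fineDom n ΩT) × ι) (↥(fineDom n ΩT) × ι) ℝ :=
  tcovDeriv n P (fineDom n ΩT) (fieldLink F (e / n) fun u v => torBond n P Ac u.1 v.1) μ

/-- THE PERIODIC EXTENSION of the torus component field to the whole fine lattice `ηℤ^{d+1}`: `A^per_ν(z) = A_ν(z mod nP)`.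
[cite: Balaban1983RegularityDecay, p.572 «periodic conditions», dictionary] -/
def perField (n : ℕ) (P : Fin (d + 1) → ℕ) (Ac : (Fin (d + 1) → ℤ) → Fin (d + 1) → ℝ) :
    (Fin (d + 1) → ℤ) → Fin (d + 1) → ℝ :=
  fun z => Ac (twrap n P z)

omit [Fintype ι] [DecidableEq ι] in
/-- the periodic extension is periodic. [cite: Balaban1983RegularityDecay, p.572 «a torus T_η … with periodic conditions», dictionary] -/
theorem perField_add_per (n : ℕ) (P : Fin (d + 1) → ℕ) (Ac : (Fin (d + 1) → ℤ) → Fin (d + 1) → ℝ)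
    (z t : Fin (d + 1) → ℤ) : perField n P Ac (z + fun ν => (per n P ν : ℤ) * t ν) = perField n P Ac z := by
  unfold perField; rw [twrap_add_per]

omit [Fintype ι] [DecidableEq ι] in
/-- on the period box the periodic extension is the field. [cite: Balaban1983RegularityDecay, p.572 «a torus T_η … with periodic conditions», dictionary] -/
theorem perField_of_mem {n : ℕ} {P : Fin (d + 1) → ℕ} (Ac : (Fin (d + 1) → ℤ) → Fin (d + 1) → ℝ)
    {z : Fin (d + 1) → ℤ} (hz : z ∈ boxDom (per n P)) : perField n P Ac z = Ac z := by
  unfold perField; rw [twrap_eq_self hz]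

omit [Fintype ι] [DecidableEq ι] in
/-- a fine period `≥ 3` divides no integer of absolute value `1` or `2`. [cite: Balaban1983RegularityDecay, p.572 «a torus T_η … with periodic conditions», dictionary] -/
theorem not_dvd_of_small {p : ℕ} (hp : 3 ≤ p) {a : ℤ} (ha0 : a ≠ 0) (ha : |a| ≤ 2) : ¬ (p : ℤ) ∣ a := by
  intro h
  have h1 : (p : ℤ) ∣ |a| := (dvd_abs _ _).2 h
  have h2 : (p : ℤ) ≤ |a| := Int.le_of_dvd (abs_pos.2 ha0) h1
  have h3 : (3 : ℤ) ≤ p := by exact_mod_cast hp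
  linarith

omit [Fintype ι] [DecidableEq ι] in
/-- in the period box, `u + e_i` reduced is `twrap(u + e_μ)` only for `μ = i` (fine period `≥ 2` would do; `≥ 3` assumed). [cite: Balaban1983RegularityDecay, p.572 «a torus T_η … with periodic conditions», dictionary] -/
theorem eq_twrap_add_e1_iff {n : ℕ} {P : Fin (d + 1) → ℕ} (h3 : ∀ ν, 3 ≤ per n P ν) {u : Fin (d + 1) → ℤ}
    {i μ : Fin (d + 1)} (hv : u + e1 i ∈ boxDom (per n P)) :
    u + e1 i = twrap n P (u + e1 μ) ↔ μ = i := by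
  constructor
  · intro h
    by_contra hne
    have h' : twrap n P (u + e1 i) = twrap n P (u + e1 μ) := by rw [twrap_eq_self hv]; exact h
    have hd := (twrap_eq_twrap_iff n P _ _).1 h' i
    simp only [Pi.add_apply, e1_apply_self, e1_apply_ne (Ne.symm hne)] at hd
    have : (u i + 1 - (u i + 0) : ℤ) = 1 := by ring
    rw [this] at hd
    exact not_dvd_of_small (h3 i) one_ne_zero (by norm_num) hd
  · rintro rfl; rw [twrap_eq_self hv]

omit [Fintype ι] [DecidableEq ι] in
/-- in the period box, `u` is never `twrap(u + e_i + e_μ)` (fine period `≥ 3`). [cite: Balaban1983RegularityDecay, p.572 «a torus T_η … with periodic conditions», dictionary] -/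
theorem ne_twrap_add_e1_add_e1 {n : ℕ} {P : Fin (d + 1) → ℕ} (h3 : ∀ ν, 3 ≤ per n P ν) {u : Fin (d + 1) → ℤ}
    (hu : u ∈ boxDom (per n P)) (i μ : Fin (d + 1)) : u ≠ twrap n P (u + e1 i + e1 μ) := by
  intro h
  have h' : twrap n P u = twrap n P (u + e1 i + e1 μ) := by rw [twrap_eq_self hu]; exact h
  have hd := (twrap_eq_twrap_iff n P _ _).1 h' i
  simp only [Pi.add_apply, e1_apply_self] at hd
  by_cases hμ : μ = i
  · subst hμ
    rw [e1_apply_self] at hd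
    have : (u μ - (u μ + 1 + 1) : ℤ) = -2 := by ring
    rw [this] at hd
    exact not_dvd_of_small (h3 μ) (by norm_num) (by norm_num) hd
  · rw [e1_apply_ne (Ne.symm hμ)] at hd
    have : (u i - (u i + 1 + 0) : ℤ) = -1 := by ring
    rw [this] at hd
    exact not_dvd_of_small (h3 i) (by norm_num) (by norm_num) hd

omit [Fintype ι] [DecidableEq ι] in
/-- **ON LATTICE BONDS OF THE PERIOD BOX THE TORUS FIELD IS THE PERIODIC COMPONENT FIELD**: for representatives `u`,
`v = u ± e_i` both in the period box (fine period `≥ 3`), `torBond u v = A^per(u, v)`.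
[cite: Balaban1983RegularityDecay, p.572 «A_{⟨x,x+ηe_μ⟩} = A_μ(x)»] -/
theorem torBond_eq_compField {n : ℕ} {P : Fin (d + 1) → ℕ} (h3 : ∀ ν, 3 ≤ per n P ν)
    (Ac : (Fin (d + 1) → ℤ) → Fin (d + 1) → ℝ) {u v : Fin (d + 1) → ℤ} (hu : u ∈ boxDom (per n P))
    (hv : v ∈ boxDom (per n P)) (huv : v ∈ nbrs u) : torBond n P Ac u v = compField (perField n P Ac) u v := by
  -- the forward bond `(u, u + e_i)` with both ends in the box
  have key : ∀ {u : Fin (d + 1) → ℤ} {i : Fin (d + 1)}, u ∈ boxDom (per n P) → u + e1 i ∈ boxDom (per n P) →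
      torBond n P Ac u (u + e1 i) = compField (perField n P Ac) u (u + e1 i) := by
    intro u i hu hv
    rw [B4Lower18RegularRegion.compField_add, perField_of_mem Ac hu, torBond]
    have h1 : ∀ μ, (u + e1 i = twrap n P (u + e1 μ)) ↔ μ = i := fun μ => eq_twrap_add_e1_iff h3 hv
    have h2 : ∀ μ, ¬ (u = twrap n P (u + e1 i + e1 μ)) := fun μ => ne_twrap_add_e1_add_e1 h3 hu i μ
    simp only [h1, h2, if_false, Finset.sum_const_zero, sub_zero]
    rw [Finset.sum_ite_eq' Finset.univ i, if_pos (Finset.mem_univ _)]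
  obtain ⟨i, hi | hi⟩ := mem_nbrs.1 huv
  · have hi' : v = u + e1 i := hi
    subst hi'
    exact key hu hv
  · have hi' : u = v + e1 i := by rw [hi]; simp [e1]
    subst hi'
    rw [torBond_rev, compField_rev, key hv hu]

/-! ## §3. The torus operator against the Neumann operator of the fundamental domain; `G_k(Ω, A)` exists on the torus -/

section Compare

variable (F : OrthFlow ι) {n : ℕ} (hn : 1 ≤ n) {P : Fin (d + 1) → ℕ} (hP : ∀ ν, 1 ≤ P ν)
  (h3 : ∀ ν, 3 ≤ per n P ν) {ΩT : Finset (Fin (d + 1) → ℤ)} (hΩ : ΩT ⊆ boxDom P)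

omit [Fintype ι] [DecidableEq ι] in
include hn hΩ in
/-- the sites of a torus region (representatives) lie in the fine period box. [cite: Balaban1983RegularityDecay, (1.1) p.572, dictionary] -/
theorem val_mem_perBox (x : ↥(fineDom n ΩT)) : x.1 ∈ boxDom (per n P) := by
  have hb : blk n x.1 ∈ boxDom P := hΩ ((mem_fineDom hn).1 x.2)
  have hn0 : (0 : ℤ) < n := by exact_mod_cast hn
  rw [mem_boxDom] at hb ⊢
  intro ν
  obtain ⟨h1, h2⟩ := hb ν
  have e1' : x.1 ν / (n : ℤ) = blk n x.1 ν := rfl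
  constructor
  · by_contra hneg
    have : x.1 ν / (n : ℤ) < 0 := Int.ediv_neg_of_neg_of_pos (lt_of_not_ge hneg) hn0
    rw [e1'] at this; linarith
  · have h2' : x.1 ν / (n : ℤ) < (P ν : ℤ) := by rw [e1']; exact h2
    rw [Int.ediv_lt_iff_lt_mul hn0] at h2'
    have : ((per n P ν : ℕ) : ℤ) = (P ν : ℤ) * n := by simp [per, mul_comm]
    rw [this]; exact h2'

omit [Fintype ι] [DecidableEq ι] hP in
include hn hΩ in
/-- lattice nearest neighbours of the period box are torus nearest neighbours. [cite: Balaban1983RegularityDecay, (1.3) p.572, dictionary] -/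
theorem tNbr_of_nbrs {u v : ↥(fineDom n ΩT)} (h : v.1 ∈ nbrs u.1) : TNbr n P u.1 v.1 := by
  obtain ⟨i, hi | hi⟩ := mem_nbrs.1 h
  · refine ⟨i, Or.inl ?_⟩
    have hi' : v.1 = u.1 + e1 i := hi
    rw [← hi', twrap_eq_self (val_mem_perBox hn hΩ v)]
  · refine ⟨i, Or.inr ?_⟩
    have hi' : u.1 = v.1 + e1 i := by rw [hi]; simp [e1]
    rw [← hi', twrap_eq_self (val_mem_perBox hn hΩ u)]

omit hP in
include hn hΩ in
/-- the torus weights dominate the lattice Neumann weights of the fundamental domain (the wrap-around bonds are extra).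
[cite: Balaban1983RegularityDecay, (1.3) p.572] -/
theorem regWt_le_torWt (u v : ↥(fineDom n ΩT)) : regWt n (fineDom n ΩT) u v ≤ torWt n P (fineDom n ΩT) u v := by
  unfold regWt torWt
  refine mul_le_mul_of_nonneg_left ?_ (by positivity)
  by_cases h : v.1 ∈ nbrs u.1
  · rw [if_pos h, if_pos (tNbr_of_nbrs hn hΩ h)]
  · rw [if_neg h]; split_ifs <;> norm_num

omit hP in
include hn h3 hΩ in
/-- on lattice bonds of the fundamental domain the torus link variables are those of the periodic component field.
[cite: Balaban1983RegularityDecay, (1.2) p.572] -/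
theorem fieldLink_tor_eq_of_nbrs (κ : ℝ) (Ac : (Fin (d + 1) → ℤ) → Fin (d + 1) → ℝ) {u v : ↥(fineDom n ΩT)}
    (h : v.1 ∈ nbrs u.1) :
    fieldLink F κ (fun a b : ↥(fineDom n ΩT) => torBond n P Ac a.1 b.1) u v
      = fieldLink F κ (fun a b : ↥(fineDom n ΩT) => compField (perField n P Ac) a.1 b.1) u v := by
  simp only [fieldLink, torBond_eq_compField h3 Ac (val_mem_perBox hn hΩ u) (val_mem_perBox hn hΩ v) h]

omit hP in
include hn h3 hΩ in
/-- THE BLOCK TRANSPORTERS OF THE TORUS REGION ARE THOSE OF THE FUNDAMENTAL DOMAIN at the periodic field (the staircase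
contours run through lattice bonds inside unit blocks). [cite: Balaban1983RegularityDecay, (1.4) p.572 «U(A(Γ^{(k)}_{y,x}))»] -/
theorem contourTrans_tor_eq (κ : ℝ) (Ac : (Fin (d + 1) → ℤ) → Fin (d + 1) → ℝ) :
    contourTrans (fieldLink F κ fun a b : ↥(fineDom n ΩT) => torBond n P Ac a.1 b.1) (rbaseEmb hn ΩT)
        (rstairContour hn ΩT)
      = contourTrans (fieldLink F κ fun a b : ↥(fineDom n ΩT) => compField (perField n P Ac) a.1 b.1)
          (rbaseEmb hn ΩT) (rstairContour hn ΩT) := by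
  funext y x
  unfold contourTrans
  exact transport_congr (r := fun u v : ↥(fineDom n ΩT) => v.1 ∈ nbrs u.1 ∧ blk n v.1 = y.1)
    (fun u v huv => fieldLink_tor_eq_of_nbrs F hn h3 hΩ κ Ac huv.1) _ _ (rstairContour_path hn ΩT y x)

omit hP in
include hn h3 hΩ in
/-- **THE TORUS FORM DOMINATES THE NEUMANN FORM OF THE FUNDAMENTAL DOMAIN**:
`⟨v, H^{ℤ}_{Ω_T}(A^per) v⟩ ≤ ⟨v, H^{T}_{Ω}(A) v⟩` — the wrap-around bonds add non-negative terms to (1.3), the block term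
(1.5) and the mass term coincide.  Hence every lower bound (1.8) of the lattice region at the periodic field is a lower
bound of the torus operator. [cite: Balaban1983RegularityDecay, (1.3)–(1.6) p.572, (1.8) p.573] -/
theorem regionOp_form_le_torusOp_form (e a m2 : ℝ) (Ac : (Fin (d + 1) → ℤ) → Fin (d + 1) → ℝ)
    (v : ↥(fineDom n ΩT) × ι → ℝ) :
    v ⬝ᵥ (regionOp F e hn a m2 ΩT (perField n P Ac) *ᵥ v) ≤ v ⬝ᵥ (torusOp F e hn a m2 P ΩT Ac *ᵥ v) := by
  rw [regionOp, torusOp, b4Op, b4Op, covOp_form, covOp_form, contourTrans_tor_eq F hn h3 hΩ]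
  have hW : covLap (regWt n (fineDom n ΩT)) (fieldLink F (e / n) fun u v : ↥(fineDom n ΩT) => compField (perField n P Ac) u.1 v.1)
      = covLap (regWt n (fineDom n ΩT)) (fieldLink F (e / n) fun u v : ↥(fineDom n ΩT) => torBond n P Ac u.1 v.1) := by
    refine covLap_congr fun u v huv => ?_
    have hnb : v.1 ∈ nbrs u.1 := by
      by_contra hc; exact huv (by simp [regWt, hc])
    exact (fieldLink_tor_eq_of_nbrs F hn h3 hΩ (e / n) Ac hnb).symm
  rw [hW]
  have hmono := covLap_form_mono (regWt_le_torWt hn hΩ)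
    (fieldLink F (e / n) fun u v : ↥(fineDom n ΩT) => torBond n P Ac u.1 v.1) v
  linarith

omit hP h3 hΩ in
include hn in
/-- the staircase contour of a weighted pair runs through torus bonds of positive weight.
[cite: Balaban1983RegularityDecay, (1.3)–(1.4) p.572] -/
theorem rstairContour_torWeighted (hΩ : ΩT ⊆ boxDom P) (y : ↥ΩT) (x : ↥(fineDom n ΩT)) :
    PathRel (fun u v : ↥(fineDom n ΩT) => 0 < torWt n P (fineDom n ΩT) u v) (rbaseEmb hn ΩT y)
      (rstairContour hn ΩT y x) := by
  refine pathRel_mono (fun u v huv => ?_) _ _ (rstairContour_path hn ΩT y x)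
  have hn' : (0 : ℝ) < n := by exact_mod_cast hn
  simp only [torWt, if_pos (tNbr_of_nbrs hn hΩ huv.1), mul_one]
  positivity

omit hP h3 in
include hn hΩ in
/-- **`−Δ^{η,N}_{A,Ω} + m² + aP_k(A)` IS POSITIVE DEFINITE ON EVERY TORUS REGION FOR EVERY `A`** (`a > 0`, `m² ≥ 0`):
p35's `B4Eq16GreenExists.b4Op_posDef` — the staircase contours run through torus bonds and end at their targets, every
site carries block weight `1`. [cite: Balaban1983RegularityDecay, (1.6) p.572] -/
theorem torusOp_posDef (e : ℝ) {a : ℝ} (ha : 0 < a) {m2 : ℝ} (hm : 0 ≤ m2)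
    (Ac : (Fin (d + 1) → ℤ) → Fin (d + 1) → ℝ) : (torusOp F e hn a m2 P ΩT Ac).PosDef := by
  have hn' : (0 : ℝ) < n := by exact_mod_cast hn
  exact b4Op_posDef F (e / n) (torWt_nonneg n P _) hm (by positivity) (rBlkWt_nonneg n ΩT _) (rBlkWt_cover hn ΩT)
    (fun y x _ => rstairContour_torWeighted hn hΩ y x) (fun y x h => rstairContour_end hn ΩT y x h) _

omit hP h3 in
include hn hΩ in
/-- … hence invertible. [cite: Balaban1983RegularityDecay, (1.6) p.572] -/
theorem torusOp_isUnit_det (e : ℝ) {a : ℝ} (ha : 0 < a) {m2 : ℝ} (hm : 0 ≤ m2)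
    (Ac : (Fin (d + 1) → ℤ) → Fin (d + 1) → ℝ) : IsUnit (torusOp F e hn a m2 P ΩT Ac).det :=
  (Matrix.isUnit_iff_isUnit_det _).1 (torusOp_posDef F hn hΩ e ha hm Ac).isUnit

omit hP h3 in
include hn hΩ in
/-- **THE TORUS GREEN'S FUNCTION `G_k(Ω, A) = (…)⁻¹` OF (1.6) EXISTS FOR EVERY `A`**: `H·G = 1`.
[cite: Balaban1983RegularityDecay, (1.6) p.572] -/
theorem torusOp_mul_inv (e : ℝ) {a : ℝ} (ha : 0 < a) {m2 : ℝ} (hm : 0 ≤ m2)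
    (Ac : (Fin (d + 1) → ℤ) → Fin (d + 1) → ℝ) :
    torusOp F e hn a m2 P ΩT Ac * (torusOp F e hn a m2 P ΩT Ac)⁻¹ = 1 :=
  Matrix.mul_nonsing_inv _ (torusOp_isUnit_det F hn hΩ e ha hm Ac)

omit hP h3 in
include hn hΩ in
/-- `G·H = 1` on the torus region. [cite: Balaban1983RegularityDecay, (1.6) p.572] -/
theorem inv_mul_torusOp (e : ℝ) {a : ℝ} (ha : 0 < a) {m2 : ℝ} (hm : 0 ≤ m2)
    (Ac : (Fin (d + 1) → ℤ) → Fin (d + 1) → ℝ) :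
    (torusOp F e hn a m2 P ΩT Ac)⁻¹ * torusOp F e hn a m2 P ΩT Ac = 1 :=
  Matrix.nonsing_inv_mul _ (torusOp_isUnit_det F hn hΩ e ha hm Ac)

omit hP h3 in
include hn hΩ in
/-- `H (G f) = f`: `G_k(Ω, A)f` solves the equation on the torus region. [cite: Balaban1983RegularityDecay, (1.6) p.572] -/
theorem torusOp_mulVec_inv_mulVec (e : ℝ) {a : ℝ} (ha : 0 < a) {m2 : ℝ} (hm : 0 ≤ m2)
    (Ac : (Fin (d + 1) → ℤ) → Fin (d + 1) → ℝ) (f : ↥(fineDom n ΩT) × ι → ℝ) :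
    torusOp F e hn a m2 P ΩT Ac *ᵥ ((torusOp F e hn a m2 P ΩT Ac)⁻¹ *ᵥ f) = f := by
  rw [Matrix.mulVec_mulVec, torusOp_mul_inv F hn hΩ e ha hm Ac, Matrix.one_mulVec]

end Compare

end

end Literature.MathematicalPhysics.QuantumFieldTheory.Balaban1983to89.B4TorusRegionOp
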